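import Literature.NumberTheory.LFunctions.MoebiusWalshGeomSums
import HarnessLib

/-!
# Counting `n` with `‖an/2^L + β‖ < δ` in an interval (Bourgain 2013, §2, (2.12)–(2.27)) — proved

Topic `Literature/NumberTheory/LFunctions`, sibling of `MoebiusWalshGeomSums.lean`. Everything here
is PROVED (theorems only); no definition, no named fact.

The type-II analysis of J. Bourgain, *Möbius–Walsh correlation bounds and an estimate of Mauduit
and Rivat*, J. Anal. Math. 119 (2013) 147–163 = arXiv:1109.2784 [Bourgain2013MoebiusWalsh], §2,
after van der Corput differencing and the Fourier expansion (2.11), is a case analysis of the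
solutions `n ∼ N` of the diophantine condition
(2.12) `‖(k-k')n/2^{μ+ρ'+K} - k'ℓ/2^{μ+ρ'}‖ < 1/M₁`
for fixed frequencies `k ≠ k'` and lag `ℓ ≠ 0`; every case ((2.16)–(2.18): "(2.16) determines
`n (mod 2^{μ+ρ'-r})` up to `1 + L^{1+2ε}2^{-r}` possibilities and hence `n` up to
`(N2^r/(ML))(1 + L^{1+2ε}2^{-r})` possibilities"; (2.17): "at most `L^{1+2ε}` possibilities for
`k' (mod 2^r)`"; (2.24): "the number of `n`'s satisfying (2.12) is at most
`(NΔk/(ML2^K))(1 + L^{1+2ε}2^K/Δk)`") is an instance of ONE counting lemma, proved here with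
explicit constants:

* `card_filter_Ico_distInt_mul_lt_le` / `card_filter_Ico_distInt_int_mul_lt_le` — for `a ≠ 0`
  (`ℕ` or `ℤ`), `δ ≥ 0`, any real shift `β`, any `2^L` and any interval of `N` consecutive integers,
  `#{n₀ ≤ n < n₀+N : ‖an/2^L + β‖ < δ} ≤ (N/2^L + 2)(2δ2^L + 2^{v₂(a)+1})`
  (`v₂(a) = a.factorization 2`; the factor `N/2^L + 2` counts the periods `2^L/…` met by the
  interval, the factor `2δ2^L + 2^{v₂(a)+1}` the solutions in one period: writing `a = 2^s a'` with
  `a'` odd, `n ↦ a'n` permutes `ℤ/2^{L-s}` and the `2^{L-s}` equally spaced points `r/2^{L-s} + β`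
  have at most `2(δ2^{L-s} + 1)` members within `δ` of `ℤ`);
* the steps: `card_filter_distInt_lt_le` (pairwise `δ'`-separated points: at most `2(δ/δ' + 1)` are
  within `δ` of an integer — two per window of `‖·‖`, from the tree's
  `Literature.NumberTheory.Sieve.Vinogradov.card_filter_distInt_mem_Ico_le_two`),
  `card_filter_distInt_div_add_lt_le` (the `Q` points `r/Q + β`), `card_filter_range_distInt_mul_lt_le`
  (one dyadic period, through `sum_range_comp_two_pow_mul` of `MoebiusWalshGeomSums.lean`),
  `sum_Ico_le_of_period_bound` (covering an interval by `≤ N/P + 2` periods).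

In the paper's normalisation: (2.16) is the case `2^L = 2^{μ+ρ'}`, `a = k₁` odd (`2^{v₂} = 1`),
`δ = 1/M₁`, giving `≲ (N/2^{μ+ρ'-r}·…)`; (2.24) is `2^L = 2^{μ+ρ'+K}`, `a = |k-k'| ∼ Δk`,
`δ = 1/M₁`, `β = -k'ℓ/2^{μ+ρ'}`.

## References

* J. Bourgain, J. Anal. Math. 119 (2013) 147–163; arXiv:1109.2784, §2 (2.12), (2.16)–(2.18),
  (2.24)–(2.27). [Bourgain2013MoebiusWalsh]
* M. B. Nathanson, *Additive Number Theory: the Classical Bases*, GTM 164, §4.4 (well-spaced points,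
  through `VinogradovExpSumTools.lean`). [Nathanson1996]
-/

noncomputable section

open Finset Real

namespace Literature.NumberTheory.LFunctions.MoebiusWalsh

open Literature.NumberTheory.Sieve.Vinogradov (distInt distInt_nonneg distInt_add_int distInt_neg
  card_filter_distInt_mem_Ico_le_two)

/-! ### Well-spaced points: few of them are close to an integer -/

/-- Among points pairwise `δ'`-separated modulo `1`, at most `2(δ/δ' + 1)` are within `δ` of an
integer (two per window `[sδ', (s+1)δ')` of `‖·‖`, `s ≤ δ/δ'`). [folklore] -/
theorem card_filter_distInt_lt_le {ι : Type*} (S : Finset ι) (x : ι → ℝ) {δ' : ℝ} (hδ' : 0 < δ')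
    (hsep : ∀ i ∈ S, ∀ j ∈ S, i ≠ j → δ' ≤ distInt (x i - x j)) {δ : ℝ} (hδ : 0 ≤ δ) :
    ((S.filter fun i => distInt (x i) < δ).card : ℝ) ≤ 2 * (δ / δ' + 1) := by
  classical
  set m := ⌊δ / δ'⌋₊ with hm
  have hsub : S.filter (fun i => distInt (x i) < δ) ⊆
      (range (m + 1)).biUnion fun s => S.filter fun i => (s : ℝ) * δ' ≤ distInt (x i) ∧ distInt (x i) < s * δ' + δ' := by
    intro i hi
    rw [Finset.mem_filter] at hi
    rw [Finset.mem_biUnion]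
    refine ⟨⌊distInt (x i) / δ'⌋₊, ?_, ?_⟩
    · rw [Finset.mem_range, Nat.lt_succ_iff, hm]
      exact Nat.floor_le_floor (div_le_div_of_nonneg_right hi.2.le hδ'.le)
    · rw [Finset.mem_filter]
      refine ⟨hi.1, ?_, ?_⟩
      · have h := Nat.floor_le (div_nonneg (distInt_nonneg (x i)) hδ'.le)
        rwa [le_div_iff₀ hδ'] at h
      · have h := Nat.lt_floor_add_one (distInt (x i) / δ')
        rw [div_lt_iff₀ hδ'] at h
        linarith
  calc ((S.filter fun i => distInt (x i) < δ).card : ℝ)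
      ≤ (((range (m + 1)).biUnion fun s => S.filter fun i =>
          (s : ℝ) * δ' ≤ distInt (x i) ∧ distInt (x i) < s * δ' + δ').card : ℝ) := by
        exact_mod_cast Finset.card_le_card hsub
    _ ≤ ∑ s ∈ range (m + 1), ((S.filter fun i => (s : ℝ) * δ' ≤ distInt (x i) ∧ distInt (x i) < s * δ' + δ').card : ℝ) := by
        exact_mod_cast Finset.card_biUnion_le
    _ ≤ ∑ _s ∈ range (m + 1), (2 : ℝ) := Finset.sum_le_sum fun s _ => by
        exact_mod_cast card_filter_distInt_mem_Ico_le_two S x hsep _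
    _ = 2 * ((m : ℝ) + 1) := by rw [Finset.sum_const, Finset.card_range, nsmul_eq_mul]; push_cast; ring
    _ ≤ 2 * (δ / δ' + 1) := by
        have : (m : ℝ) ≤ δ / δ' := Nat.floor_le (div_nonneg hδ hδ'.le)
        linarith

/-- **A full set of `Q` equally spaced points**: `#{r < Q : ‖r/Q + β‖ < δ} ≤ 2(δQ + 1)`. [folklore] -/
theorem card_filter_distInt_div_add_lt_le {Q : ℕ} (hQ : 0 < Q) (β : ℝ) {δ : ℝ} (hδ : 0 ≤ δ) :
    (((range Q).filter fun r : ℕ => distInt ((r : ℝ) / Q + β) < δ).card : ℝ) ≤ 2 * (δ * Q + 1) := by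
  have hQr : (0 : ℝ) < Q := by exact_mod_cast hQ
  have h := card_filter_distInt_lt_le (range Q) (fun r : ℕ => (r : ℝ) / Q + β) (δ' := 1 / Q) (by positivity)
    (fun i hi j hj hij => one_div_le_distInt_sub (Finset.mem_range.1 hi) (Finset.mem_range.1 hj) hij β) hδ
  rwa [div_div_eq_mul_div, div_one] at h

/-! ### The indicator as a periodic test function; a full dyadic period; an interval -/

/-- The count over a full period `[0, 2^L)` along the multiples of `a ≠ 0`:
`#{k < 2^L : ‖ak/2^L + β‖ < δ} ≤ 2δ2^L + 2^{v₂(a)+1}` (multiplication by the odd part of `a`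
permutes the residues; the `2^{v₂(a)}` collapses each hit `2^{v₂(a)}` times). This is the count
behind Bourgain 2013, (2.16)–(2.18) ("(2.16) determines `n (mod 2^{μ+ρ'-r})` up to
`1 + L^{1+2ε}2^{-r}` possibilities"). [cite: Bourgain2013MoebiusWalsh, (2.16)–(2.18)] -/
theorem card_filter_range_distInt_mul_lt_le {a : ℕ} (ha : a ≠ 0) (L : ℕ) (β : ℝ) {δ : ℝ} (hδ : 0 ≤ δ) :
    (((range (2 ^ L)).filter fun k : ℕ => distInt (((a * k : ℕ) : ℝ) / 2 ^ L + β) < δ).card : ℝ) ≤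
      2 * δ * 2 ^ L + 2 ^ (a.factorization 2 + 1) := by
  classical
  -- the indicator as a `1`-periodic test function
  set F : ℝ → ℝ := fun y => if distInt (y + β) < δ then 1 else 0 with hF
  have hFper : ∀ (y : ℝ) (n : ℕ), F (y + n) = F y := by
    intro y n
    simp only [hF]
    rw [show y + n + β = (y + β) + ((n : ℤ) : ℝ) by push_cast; ring, distInt_add_int]
  have hF01 : ∀ y, 0 ≤ F y ∧ F y ≤ 1 := fun y => by
    simp only [hF]; split_ifs <;> norm_num
  have hcount : ∀ (s : Finset ℕ) (g : ℕ → ℝ),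
      (((s.filter fun k => distInt (g k + β) < δ).card : ℝ)) = ∑ k ∈ s, F (g k) := by
    intro s g
    rw [Finset.card_filter, Nat.cast_sum]
    refine Finset.sum_congr rfl fun k _ => ?_
    rw [hF]; dsimp only; split_ifs <;> simp
  have hgoal := hcount (range (2 ^ L)) (fun k => ((a * k : ℕ) : ℝ) / 2 ^ L)
  rw [hgoal]
  obtain ⟨a', ha', haeq⟩ := exists_eq_two_pow_factorization_mul_odd ha
  set s := a.factorization 2 with hs
  rcases le_or_gt s L with hsL | hsL
  · obtain ⟨t, rfl⟩ : ∃ t, L = t + s := ⟨L - s, by omega⟩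
    rw [haeq]
    rw [sum_range_comp_two_pow_mul (s := s) (t := t) ha' F hFper]
    have hper : ∑ r ∈ range (2 ^ t), F ((r : ℝ) / 2 ^ t) ≤ 2 * (δ * 2 ^ t + 1) := by
      have h := card_filter_distInt_div_add_lt_le (Nat.two_pow_pos t) β hδ
      have h2 := hcount (range (2 ^ t)) (fun r => (r : ℝ) / ((2 ^ t : ℕ) : ℝ))
      rw [h2] at h
      push_cast at h
      exact h
    calc (2 : ℝ) ^ s * ∑ r ∈ range (2 ^ t), F ((r : ℝ) / 2 ^ t) ≤ 2 ^ s * (2 * (δ * 2 ^ t + 1)) :=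
          mul_le_mul_of_nonneg_left hper (by positivity)
      _ = 2 * δ * 2 ^ (t + s) + 2 ^ (s + 1) := by rw [pow_add, pow_succ]; ring
  · -- `s > L`: every point is an integer shift of `β`; at most `2^L ≤ 2^s` terms, each `≤ 1`
    calc ∑ k ∈ range (2 ^ L), F (((a * k : ℕ) : ℝ) / 2 ^ L) ≤ ∑ _k ∈ range (2 ^ L), (1 : ℝ) :=
          Finset.sum_le_sum fun k _ => (hF01 _).2
      _ = 2 ^ L := by rw [Finset.sum_const, Finset.card_range, nsmul_eq_mul, mul_one]; push_cast; ring
      _ ≤ 2 ^ (s + 1) := pow_le_pow_right₀ (by norm_num) (by omega)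
      _ ≤ 2 * δ * 2 ^ L + 2 ^ (s + 1) := le_add_of_nonneg_left (by positivity)

/-- **Covering an interval by full periods**: if `g ≥ 0` on `ℕ` satisfies
`∑_{k<P} g(Pt + k) ≤ B` for every `t`, then `∑_{n₀ ≤ n < n₀+N} g(n) ≤ (N/P + 2) B`. [folklore] -/
theorem sum_Ico_le_of_period_bound {g : ℕ → ℝ} (hg : ∀ n, 0 ≤ g n) {P : ℕ} (hP : 0 < P) {B : ℝ}
    (hB : ∀ t : ℕ, ∑ k ∈ range P, g (P * t + k) ≤ B) (n₀ N : ℕ) :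
    ∑ n ∈ Ico n₀ (n₀ + N), g n ≤ ((N : ℝ) / P + 2) * B := by
  set t₀ := n₀ / P with ht₀
  set T := N / P + 2 with hT
  have hB0 : 0 ≤ B := le_trans (Finset.sum_nonneg fun k _ => hg _) (hB 0)
  have hsub : Ico n₀ (n₀ + N) ⊆ Ico (P * t₀) (P * t₀ + P * T) := by
    intro n hn
    rw [Finset.mem_Ico] at hn ⊢
    have h1 : P * t₀ ≤ n₀ := Nat.mul_div_le n₀ P
    have h2 : n₀ < P * t₀ + P := by rw [ht₀]; have := Nat.lt_mul_div_succ n₀ hP; linarith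
    have h3 : N < P * (N / P) + P := by have := Nat.lt_mul_div_succ N hP; linarith
    constructor
    · omega
    · rw [hT]; nlinarith
  calc ∑ n ∈ Ico n₀ (n₀ + N), g n ≤ ∑ n ∈ Ico (P * t₀) (P * t₀ + P * T), g n :=
        Finset.sum_le_sum_of_subset_of_nonneg hsub fun n _ _ => hg n
    _ = ∑ u ∈ range T, ∑ k ∈ range P, g (P * (t₀ + u) + k) := by
        rw [Finset.sum_Ico_eq_sum_range, show P * t₀ + P * T - P * t₀ = P * T by omega,
          sum_range_mul_eq_sum_sum]
        refine Finset.sum_congr rfl fun u _ => Finset.sum_congr rfl fun k _ => ?_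
        congr 1; ring
    _ ≤ ∑ _u ∈ range T, B := Finset.sum_le_sum fun u _ => hB _
    _ = (T : ℝ) * B := by rw [Finset.sum_const, Finset.card_range, nsmul_eq_mul]
    _ ≤ ((N : ℝ) / P + 2) * B := by
        refine mul_le_mul_of_nonneg_right ?_ hB0
        rw [hT]; push_cast
        have : ((N / P : ℕ) : ℝ) ≤ (N : ℝ) / P := Nat.cast_div_le
        linarith

/-- **Bourgain 2013, §2, the count in (2.12)/(2.16)/(2.24)**: for `a ≠ 0`, `δ ≥ 0`, any `β` and
any interval of `N` consecutive integers,
`#{n₀ ≤ n < n₀+N : ‖an/2^L + β‖ < δ} ≤ (N/2^L + 2)(2δ2^L + 2^{v₂(a)+1})`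
("for fixed `k, k', ℓ`, (2.16) determines `n (mod 2^{μ+ρ'-r})` up to `1 + L^{1+2ε}2^{-r}`
possibilities and hence `n` up to `(N2^r/(ML))(1 + L^{1+2ε}2^{-r})` possibilities"; "the number of
`n`'s satisfying (2.12) is at most `(NΔk/(ML2^K))(1 + L^{1+2ε}2^K/Δk)`").
[cite: Bourgain2013MoebiusWalsh, (2.12), (2.16)–(2.18), (2.24)] -/
theorem card_filter_Ico_distInt_mul_lt_le {a : ℕ} (ha : a ≠ 0) (L : ℕ) (β : ℝ) {δ : ℝ} (hδ : 0 ≤ δ)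
    (n₀ N : ℕ) :
    ((((Ico n₀ (n₀ + N)).filter fun n : ℕ => distInt (((a * n : ℕ) : ℝ) / 2 ^ L + β) < δ).card : ℕ) : ℝ) ≤
      ((N : ℝ) / 2 ^ L + 2) * (2 * δ * 2 ^ L + 2 ^ (a.factorization 2 + 1)) := by
  classical
  set F : ℕ → ℝ := fun n => if distInt (((a * n : ℕ) : ℝ) / 2 ^ L + β) < δ then 1 else 0 with hF
  have hcount : (((((Ico n₀ (n₀ + N)).filter fun n : ℕ =>
      distInt (((a * n : ℕ) : ℝ) / 2 ^ L + β) < δ).card : ℕ) : ℝ)) = ∑ n ∈ Ico n₀ (n₀ + N), F n := by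
    rw [Finset.card_filter, Nat.cast_sum]
    refine Finset.sum_congr rfl fun k _ => ?_
    rw [hF]; dsimp only; split_ifs <;> simp
  rw [hcount]
  have hF0 : ∀ n, 0 ≤ F n := fun n => by rw [hF]; dsimp only; split_ifs <;> norm_num
  have hmain := sum_Ico_le_of_period_bound hF0 (Nat.two_pow_pos L)
    (B := 2 * δ * 2 ^ L + 2 ^ (a.factorization 2 + 1)) (fun t => ?_) n₀ N
  · push_cast at hmain
    exact hmain
  -- one full period, shifted by `2^L t`: the shift moves `β` by the integer `a t`
  have hshift : ∀ k : ℕ, F (2 ^ L * t + k) =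
      (if distInt (((a * k : ℕ) : ℝ) / 2 ^ L + (β + (a * t : ℕ))) < δ then 1 else 0) := by
    intro k
    rw [hF]; dsimp only
    rw [show (((a * (2 ^ L * t + k) : ℕ) : ℝ) / 2 ^ L + β) = ((a * k : ℕ) : ℝ) / 2 ^ L + (β + (a * t : ℕ)) by
      push_cast; field_simp; ring]
  rw [Finset.sum_congr rfl fun k _ => hshift k]
  have h := card_filter_range_distInt_mul_lt_le ha L (β + (a * t : ℕ)) hδ
  rw [Finset.card_filter, Nat.cast_sum] at h
  refine le_trans (le_of_eq (Finset.sum_congr rfl fun k _ => ?_)) h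
  split_ifs <;> simp

/-- The same count for an integer multiplier `d ≠ 0` (`‖·‖` is even), as it occurs with
`d = k - k'` in (2.12). [cite: Bourgain2013MoebiusWalsh, (2.12)] -/
theorem card_filter_Ico_distInt_int_mul_lt_le {d : ℤ} (hd : d ≠ 0) (L : ℕ) (β : ℝ) {δ : ℝ} (hδ : 0 ≤ δ)
    (n₀ N : ℕ) :
    ((((Ico n₀ (n₀ + N)).filter fun n : ℕ => distInt ((d : ℝ) * n / 2 ^ L + β) < δ).card : ℕ) : ℝ) ≤
      ((N : ℝ) / 2 ^ L + 2) * (2 * δ * 2 ^ L + 2 ^ (d.natAbs.factorization 2 + 1)) := by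
  have ha : d.natAbs ≠ 0 := Int.natAbs_ne_zero.2 hd
  rcases le_or_gt 0 d with h | h
  · have hd' : (d : ℝ) = (d.natAbs : ℕ) := by
      rw [← Int.cast_natCast (R := ℝ), Int.natCast_natAbs, Int.cast_abs, abs_of_nonneg (by exact_mod_cast h)]
    refine le_trans (le_of_eq ?_) (card_filter_Ico_distInt_mul_lt_le ha L β hδ n₀ N)
    congr 2
    refine Finset.filter_congr fun n _ => ?_
    rw [hd']; push_cast; ring_nf
  · have hd' : (d : ℝ) = -((d.natAbs : ℕ) : ℝ) := by
      rw [← Int.cast_natCast (R := ℝ), Int.natCast_natAbs, Int.cast_abs, abs_of_neg (by exact_mod_cast h)]; ring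
    refine le_trans (le_of_eq ?_) (card_filter_Ico_distInt_mul_lt_le ha L (-β) hδ n₀ N)
    congr 2
    refine Finset.filter_congr fun n _ => ?_
    rw [hd', ← distInt_neg]
    push_cast; ring_nf

end Literature.NumberTheory.LFunctions.MoebiusWalsh

end
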